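import Summits.BirchSwinnertonDyer.BirchSwinnertonDyer.Theorems.PrintCFramBottomClassIndexLawFiveLeParitySplitPrimitivityFieldFactor
import Literature.NumberTheory.EllipticCurves.ComplexMultiplicationLFunctionIsogenyHoldsProofs
import HarnessLib

/-!
# Crux `PrintCFram.BottomClassIndexLawFiveLe` (stmt-BirchSwinnertonDyer-20372), line `eisenstein-resource-bdp-line` (registry v19):
# THE Ш-CURRENCY READING OF STUB C, CONVERSE HALF — a UNIT `K''`-factor makes the whole rational `p`-isogeny class of the
# Heegner twist `Ш[p]`-trivial (the class factor is an ISOGENY INVARIANT of class members)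
# (cell `bsd-print-cfram`, width seat `bsd-line-cfram-p1-w5` g4; THEOREMS ONLY, `--supports` 20372; BSD is not proved by any of this)

HONEST FRAMING. THEOREMS ONLY (0 defs / 0 facts / 0 sorry); nothing about BSD is proved; no stub is closed; no summit statement is
proved by this seat; the crux C2 stays OPEN and is NOT claimed false. Companion of `…HeegnerTwistShaSupply` (this seat: unit field
factor ⟸ `Ш[p]`-trivial twist pair). Here the converse: w3 g9's `ParitySplit.noPTorsion_twist_of_unit_fieldFactor` gives
`Ш(Wd)[p] = 0` for every globally minimal model `Wd` of `W^{(d_{K''})}` from a UNIT field factor (+ Cassels–Tate, GZK,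
`L(W^{(d)},1) ≠ 0`); this file extends it to the `p`-isogenous PARTNER of `Wd`, through one new dictionary entry: the CLASS FACTOR
`B_{1,ψ⁻¹}` of an odd datum is the SAME for `ℚ`-ISOGENOUS curves (isogenous curves have the same formal `L`-function —
`LFunction_eq_of_isIsogenous_holds`, Knapp Thm. 11.67 — so their trace forms are congruent off `p·N·N'`, and the Eisenstein pair is
unique up to `ψ ↔ ψ⁻¹ω`, `EisensteinPair.eq_or_eq_of_traceForm_congr`, the swap being excluded by parity).

* §1 `bernoulliOnePrim_inv_eq_of_traceForm_congr_odd` — two ODD data `ψ₁, ψ₂` (levels `f₁, f₂`), one Teichmüller `ω`, trace forms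
  congruent mod `p` at every prime `ℓ ∤ N` ⊢ `B_{1,ψ₂⁻¹} = B_{1,ψ₁⁻¹}` (on primitive characters).
* §2 **`classFactor_eq_of_isIsogenous`** — `V₁ ~ V₂` isogenous over `ℚ`, odd data `(fᵢ, ψᵢ, ωᵢ)` with `hss` for `Vᵢ` ⊢
  `bernoulliOnePrim ψ₁⁻¹ = bernoulliOnePrim ψ₂⁻¹`: Eisenstein-regularity is a property of the rational isogeny class.
* §3 **`twist_noPTorsion_pair_of_unit_fieldFactor`** — class member `W` (CM, `CMRamified W p`, `p ≥ 5`), odd datum `(f, ψ, ω)` + `hss`,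
  `K''` imaginary quadratic with Kronecker `ε` and UNIT field factor `¬ ‖B_{1,(ψεω⁻¹)~}‖ ≤ p⁻¹`, a globally minimal
  `C • W.quadraticTwist d_{K''} = Wd` with `L(W^{(d)},1) ≠ 0` ⊢ `Ш(Wd)[p] = 0` AND `Ш(W₁)[p] = 0` for every globally minimal CM-ramified
  `W₁` with a `p`-isogeny `Wd → W₁` (mod Cassels–Tate `hCT` and GZK). With `…HeegnerTwistShaSupply.not_fieldFactor_le_of_twist_noPTorsion_pair`
  this is the IFF «unit field factor at `K''` ⟺ `Ш[p]`-trivial Heegner twist pair» (mod MW, GZK, CT), stated in the END STATE file.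

beyond-print theorem: NO (dictionary). CONDITIONAL on the named facts. References: [KrizLi2019] Thm. 1.20 (p. 8), §2 (pp. 11–12),
§7.1 (p. 43); [Knapp1993] Thm. 11.67; [Cassels1962ArithmeticIV]; [SilvermanAEC2009] X.4 (Thm. 4.14), X.5 Cor. 5.4;
crux workfiles `Lines/eisenstein-resource-bdp-line-w3g9-notes.md`, HOME/HANDOFF §line-cfram-p1-w5 g3 FINAL.
-/

set_option autoImplicit false
-- `…BirchSwinnertonDyer.BirchSwinnertonDyer.Theorems…` is the problem's mandated namespace (D-0017).
set_option linter.dupNamespace false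

noncomputable section

open scoped Classical

namespace Summit.BirchSwinnertonDyer.BirchSwinnertonDyer.Theorems.PrintCFram.HeegnerTwistSha

open WeierstrassCurve NumberField IsDedekindDomain DirichletCharacter
  Literature.NumberTheory.EllipticCurves
  Literature.NumberTheory.EllipticCurves.Rank1Residual
  Literature.NumberTheory.EllipticCurves.KrizLi2019
  Literature.NumberTheory.NumberFields
  Summit.BirchSwinnertonDyer.BirchSwinnertonDyer.Theorems.PrintCFram

variable {p : ℕ} [hp : Fact p.Prime]

/-! ## §1 Two odd data with congruent trace forms have the same class factor -/

/-- **Congruent trace forms, both data ODD ⟹ the same `B_{1,ψ⁻¹}`.** For an odd prime `p`, ODD `ℚ_p`-valued characters `ψ₁` (level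
`f₁`) and `ψ₂` (level `f₂`), a Teichmüller `ω`, and `N ≠ 0` such that the trace forms `ψᵢ(ℓ) + ψᵢ⁻¹(ℓ)ω(ℓ)` agree modulo `p` at
every prime `ℓ ∤ N`: `bernoulliOnePrim ψ₂⁻¹ = bernoulliOnePrim ψ₁⁻¹`. By uniqueness of the Eisenstein pair
(`EisensteinPair.eq_or_eq_of_traceForm_congr`) `ψ₂↑ = ψ₁↑` or `ψ₂↑ = ψ₁⁻¹↑ω↑` at level `f₁f₂p`; the second is excluded by parity
(`ψ₂(−1) = −1`, `ψ₁⁻¹(−1)ω(−1) = +1`, `p ≠ 2`), and `B_{1,·}` of the primitive character does not see `changeLevel`.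
[cite: KrizLi2019, §2 (p. 11) and §7.1 (p. 43, «interchange ψ and ψ⁻¹ω»)] [cite: Washington1997, §5.1] -/
theorem bernoulliOnePrim_inv_eq_of_traceForm_congr_odd (hp2 : p ≠ 2) {f₁ f₂ : ℕ} [NeZero f₁] [NeZero f₂]
    (ψ₁ : DirichletCharacter ℚ_[p] f₁) (ψ₂ : DirichletCharacter ℚ_[p] f₂) (ω : DirichletCharacter ℚ_[p] p)
    (hψ₁ : ψ₁.Odd) (hψ₂ : ψ₂.Odd) (hω : IsTeichmullerCharacter ω) {N : ℕ} (hN : N ≠ 0)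
    (h : ∀ ℓ : ℕ, ℓ.Prime → ¬ ℓ ∣ N →
      ‖(ψ₁ (ℓ : ZMod f₁) + ψ₁⁻¹ (ℓ : ZMod f₁) * ω (ℓ : ZMod p)) -
        (ψ₂ (ℓ : ZMod f₂) + ψ₂⁻¹ (ℓ : ZMod f₂) * ω (ℓ : ZMod p))‖ < 1) :
    bernoulliOnePrim ψ₂⁻¹ = bernoulliOnePrim ψ₁⁻¹ := by
  haveI : NeZero (f₁ * f₂ * p) := ⟨Nat.mul_ne_zero (Nat.mul_ne_zero (NeZero.ne f₁) (NeZero.ne f₂)) hp.out.ne_zero⟩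
  have h₁ : f₁ ∣ f₁ * f₂ * p := ⟨f₂ * p, by ring⟩
  have h₂ : f₂ ∣ f₁ * f₂ * p := ⟨f₁ * p, by ring⟩
  have hpM : p ∣ f₁ * f₂ * p := dvd_mul_left p _
  rcases EisensteinPair.eq_or_eq_of_traceForm_congr hp2 h₁ h₂ hpM ψ₁ ψ₂ ω hN h with e | e
  · calc bernoulliOnePrim ψ₂⁻¹ = bernoulliOnePrim (changeLevel h₂ ψ₂⁻¹) :=
          (RegularLocusBernoulliPair.bernoulliOnePrim_changeLevel h₂ ψ₂⁻¹).symm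
      _ = bernoulliOnePrim (changeLevel h₁ ψ₁⁻¹) := by rw [map_inv, e, ← map_inv]
      _ = bernoulliOnePrim ψ₁⁻¹ := RegularLocusBernoulliPair.bernoulliOnePrim_changeLevel h₁ _
  · -- parity: `ψ₂` odd, `ψ₁⁻¹ω` even
    exfalso
    have h1 := congrArg (fun χ : DirichletCharacter ℚ_[p] (f₁ * f₂ * p) => χ (-1)) e
    simp only [MulChar.mul_apply, EisensteinPair.changeLevel_apply_neg_one] at h1
    have hinv : ψ₁⁻¹ (-1 : ZMod f₁) = -1 := by
      rw [MulChar.inv_apply_eq_inv', hψ₁, inv_neg, inv_one]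
    rw [hψ₂, hinv, KrizLiBinders.teichmuller_apply_neg_one hp2 hω] at h1
    have h2 : (2 : ℚ_[p]) = 0 := by linear_combination -h1
    exact two_ne_zero h2

/-! ## §2 The class factor is an invariant of the rational isogeny class -/

/-- **EISENSTEIN-REGULARITY IS AN ISOGENY INVARIANT.** Let `V₁, V₂/ℚ` be elliptic and isogenous over `ℚ`, `p ≥ 5`, and
`(f₁, ψ₁, ω₁)`, `(f₂, ψ₂, ω₂)` character data with `ψᵢ` ODD, `ωᵢ` Teichmüller and Kriz–Li's trace congruence `hssᵢ` for `Vᵢ` at every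
prime `ℓ ∤ pN_{Vᵢ}`. Then the CLASS FACTORS agree: `bernoulliOnePrim ψ₁⁻¹ = bernoulliOnePrim ψ₂⁻¹`. Isogenous curves have the same
formal `L`-function (`LFunction_eq_of_isIsogenous_holds`), so the two trace forms are congruent at every `ℓ ∤ p·N_{V₁}·N_{V₂}`
(ultrametric inequality) and §1 applies (with `ω₁ = ω₂` by uniqueness of the Teichmüller character). No conductor comparison is needed.
[cite: Knapp1993, Thm. 11.67 (PDF p. 281)] [cite: KrizLi2019, Thm. 1.20 (p. 8), §2 (p. 11) and §7.1 (p. 43)] -/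
theorem classFactor_eq_of_isIsogenous (h5 : 5 ≤ p) (V₁ V₂ : WeierstrassCurve ℚ) [V₁.IsElliptic] [V₂.IsElliptic]
    (hiso : IsIsogenous V₁ V₂) {f₁ f₂ : ℕ} [NeZero f₁] [NeZero f₂]
    (ψ₁ : DirichletCharacter ℚ_[p] f₁) (ψ₂ : DirichletCharacter ℚ_[p] f₂) (ω₁ ω₂ : DirichletCharacter ℚ_[p] p)
    (hψ₁ : ψ₁.Odd) (hψ₂ : ψ₂.Odd) (hω₁ : IsTeichmullerCharacter ω₁) (hω₂ : IsTeichmullerCharacter ω₂)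
    (hss₁ : ∀ ℓ : ℕ, ℓ.Prime → ¬ (ℓ ∣ p * V₁.conductorNorm ℤ) →
      ‖((V₁.LFunction ℓ : ℤ) : ℚ_[p]) - (ψ₁ (ℓ : ZMod f₁) + ψ₁⁻¹ (ℓ : ZMod f₁) * ω₁ (ℓ : ZMod p))‖ < 1)
    (hss₂ : ∀ ℓ : ℕ, ℓ.Prime → ¬ (ℓ ∣ p * V₂.conductorNorm ℤ) →
      ‖((V₂.LFunction ℓ : ℤ) : ℚ_[p]) - (ψ₂ (ℓ : ZMod f₂) + ψ₂⁻¹ (ℓ : ZMod f₂) * ω₂ (ℓ : ZMod p))‖ < 1) :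
    bernoulliOnePrim ψ₁⁻¹ = bernoulliOnePrim ψ₂⁻¹ := by
  have hp2 : p ≠ 2 := by omega
  obtain rfl : ω₁ = ω₂ := OffLocusDictionary.eq_of_isTeichmullerCharacter hp2 hω₁ hω₂
  have hL : V₁.LFunction = V₂.LFunction := LFunction_eq_of_isIsogenous_holds V₁ V₂ hiso
  have hN0 : p * V₁.conductorNorm ℤ * V₂.conductorNorm ℤ ≠ 0 :=
    Nat.mul_ne_zero (Nat.mul_ne_zero hp.out.ne_zero (V₁.conductorNorm_pos_holds).ne') (V₂.conductorNorm_pos_holds).ne'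
  have hcongr : ∀ ℓ : ℕ, ℓ.Prime → ¬ ℓ ∣ p * V₁.conductorNorm ℤ * V₂.conductorNorm ℤ →
      ‖(ψ₁ (ℓ : ZMod f₁) + ψ₁⁻¹ (ℓ : ZMod f₁) * ω₁ (ℓ : ZMod p)) -
        (ψ₂ (ℓ : ZMod f₂) + ψ₂⁻¹ (ℓ : ZMod f₂) * ω₁ (ℓ : ZMod p))‖ < 1 := by
    intro ℓ hℓ hℓN
    have hℓ₁ : ¬ ℓ ∣ p * V₁.conductorNorm ℤ := fun hd => hℓN (dvd_mul_of_dvd_left hd _)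
    have hℓ₂ : ¬ ℓ ∣ p * V₂.conductorNorm ℤ := fun hd => hℓN (by
      obtain ⟨c, hc⟩ := hd
      exact ⟨c * V₁.conductorNorm ℤ, by rw [mul_right_comm, hc]; ring⟩)
    have e : (ψ₁ (ℓ : ZMod f₁) + ψ₁⁻¹ (ℓ : ZMod f₁) * ω₁ (ℓ : ZMod p)) -
          (ψ₂ (ℓ : ZMod f₂) + ψ₂⁻¹ (ℓ : ZMod f₂) * ω₁ (ℓ : ZMod p)) =
        (((V₂.LFunction ℓ : ℤ) : ℚ_[p]) - (ψ₂ (ℓ : ZMod f₂) + ψ₂⁻¹ (ℓ : ZMod f₂) * ω₁ (ℓ : ZMod p))) -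
          (((V₁.LFunction ℓ : ℤ) : ℚ_[p]) - (ψ₁ (ℓ : ZMod f₁) + ψ₁⁻¹ (ℓ : ZMod f₁) * ω₁ (ℓ : ZMod p))) := by
      rw [hL]; ring
    rw [e, sub_eq_add_neg]
    refine lt_of_le_of_lt (IsUltrametricDist.norm_add_le_max _ _) (max_lt (hss₂ ℓ hℓ hℓ₂) ?_)
    rw [norm_neg]; exact hss₁ ℓ hℓ hℓ₁
  exact (bernoulliOnePrim_inv_eq_of_traceForm_congr_odd hp2 ψ₁ ψ₂ ω₁ hψ₁ hψ₂ hω₁ hN0 hcongr).symm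

/-! ## §3 A unit field factor makes the Heegner twist pair `Ш[p]`-trivial -/

/-- **`Ш[p]`-TRIVIAL TWIST PAIR FROM A UNIT FIELD FACTOR.** Let `W/ℚ` be elliptic with CM, `p ≥ 5` CM-ramified, `(f, ψ, ω)` an odd
datum with `hss` for `W`, `K` imaginary quadratic with Kronecker `ε_K` and UNIT FIELD FACTOR `¬ ‖B_{1,(ψε_Kω⁻¹)~}‖_p ≤ p⁻¹`, and `Wd` a
globally minimal model of `W^{(d_K)}` with `L(W^{(d_K)},1) ≠ 0`. Then, granting Cassels–Tate and GZK: `Ш(Wd/ℚ)[p] = 0` (w3 g9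
`ParitySplit.noPTorsion_twist_of_unit_fieldFactor`), AND `Ш(W₁/ℚ)[p] = 0` for every globally minimal, CM, CM-ramified `W₁` with a
`p`-isogeny `Wd → W₁`: `W₁` is a class member with its own odd datum, whose class factor equals that of `Wd` (§2, isogeny invariance),
which equals the field factor (w3 g7 `OffLocusTwistFactor.classFactor_twist_eq_fieldFactor`) — a unit; so `#Sel_p(W₁/ℚ) ≤ p`
((α′) `LevelDictionaryAlpha.natCard_selmerGroup_le_of_unit_classFactor`) and `r_an(W₁) = r_an(Wd) = 0` force `Ш(W₁)[p] = 0`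
(`ParitySplit.noPTorsion_of_natCard_selmerGroup_le_of_analyticRank_zero`). CONDITIONAL on `hCT`, `hGZK`; closes no stub.
[cite: Cassels1962ArithmeticIV] [cite: KrizLi2019, Thm. 1.20 (p. 8) and §7.1 (p. 43)] [cite: Knapp1993, Thm. 11.67]
[cite: SilvermanAEC2009, Thm X.4.14 and X.5 Cor. 5.4] -/
theorem twist_noPTorsion_pair_of_unit_fieldFactor
    (hCT : exists_casselsTate_pairing (K := ℚ)) (hGZK : rank_eq_analyticRank_of_analyticRank_le_one)
    (W : WeierstrassCurve ℚ) [W.IsElliptic] (hCM : W.HasCM) (hram : CMRamified W p) (h5 : 5 ≤ p)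
    {f : ℕ} [NeZero f] (ψ : DirichletCharacter ℚ_[p] f) (ω : DirichletCharacter ℚ_[p] p)
    (hψ : ψ.Odd) (hω : IsTeichmullerCharacter ω)
    (hss : ∀ ℓ : ℕ, ℓ.Prime → ¬ (ℓ ∣ p * W.conductorNorm ℤ) →
      ‖((W.LFunction ℓ : ℤ) : ℚ_[p]) - (ψ (ℓ : ZMod f) + ψ⁻¹ (ℓ : ZMod f) * ω (ℓ : ZMod p))‖ < 1)
    (K : Type) [Field K] [NumberField K] (hK : IsImaginaryQuadratic K)
    (εK : DirichletCharacter ℚ_[p] (NumberField.discr K).natAbs) (hεK : IsKroneckerCharacterOf K εK)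
    (hfld : ¬ ‖bernoulliOnePrim (bernoulliCharTwo ψ εK ω)‖ ≤ (p : ℝ)⁻¹)
    (Wd : WeierstrassCurve ℚ) [Wd.IsElliptic] [Wd.IsGloballyMinimal]
    (hC : ∃ C : VariableChange ℚ, C • W.quadraticTwist (NumberField.discr K : ℚ) = Wd)
    (hLt : (W.quadraticTwist (NumberField.discr K : ℚ)).entireLFunction 1 ≠ 0) :
    (∀ c ∈ Wd.sha, p • c = 0 → c = 0) ∧
    ∀ (W₁ : WeierstrassCurve ℚ) [W₁.IsElliptic] [W₁.IsGloballyMinimal], W₁.HasCM → CMRamified W₁ p →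
      (∃ φ : Isogeny Wd W₁, φ.degree = p) → ∀ c ∈ W₁.sha, p • c = 0 → c = 0 := by
  have hD0 : (NumberField.discr K : ℚ) ≠ 0 := by exact_mod_cast NumberField.discr_ne_zero K
  obtain ⟨hCMd, hramd⟩ := ParitySplit.hasCM_and_cmRamified_of_smul_quadraticTwist W hCM hram hD0 Wd hC
  -- `Ш(Wd)[p] = 0` (w3 g9)
  have hWd := ParitySplit.noPTorsion_twist_of_unit_fieldFactor hCT hGZK W hCM hram h5 ψ ω hψ hω hss K hK εK hεK hfld Wd hC hLt
  refine ⟨fun c hc hpc ↦ ?_, fun W₁ _ _ hCM₁ hram₁ hφ c hc hpc ↦ ?_⟩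
  · have hx : ((p : ℤ) • (⟨c, hc⟩ : Wd.sha)) = 0 := by rw [natCast_zsmul]; exact Subtype.ext hpc
    exact congrArg Subtype.val (hWd ⟨c, hc⟩ hx)
  · -- the twist's own odd datum, read on the literal twist
    obtain ⟨f', hf', ψ', ω', -, -, hψ', hω', hss', -, -, -, -⟩ :=
      OffLocusDictionary.exists_krizLiTriple_odd_of_cmRamified Wd p hCMd hramd h5 K hK.1
    haveI := hf'
    obtain ⟨C, hCd⟩ := hC
    haveI : (W.quadraticTwist (NumberField.discr K : ℚ)).IsElliptic := W.isElliptic_quadraticTwist hD0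
    have hssX : ∀ ℓ : ℕ, ℓ.Prime → ¬ (ℓ ∣ p * (W.quadraticTwist (NumberField.discr K : ℚ)).conductorNorm ℤ) →
        ‖(((W.quadraticTwist (NumberField.discr K : ℚ)).LFunction ℓ : ℤ) : ℚ_[p]) -
          (ψ' (ℓ : ZMod f') + ψ'⁻¹ (ℓ : ZMod f') * ω' (ℓ : ZMod p))‖ < 1 := by
      intro ℓ hℓ hℓN
      have hN : Wd.conductorNorm ℤ = (W.quadraticTwist (NumberField.discr K : ℚ)).conductorNorm ℤ := by
        rw [← hCd]; exact conductorNorm_smul_rat (W.quadraticTwist (NumberField.discr K : ℚ)) C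
      have hL : Wd.LFunction = (W.quadraticTwist (NumberField.discr K : ℚ)).LFunction := by
        rw [← hCd]; exact LFunction_smul (W.quadraticTwist (NumberField.discr K : ℚ)) C
      have h := hss' ℓ hℓ (by rw [hN]; exact hℓN)
      rw [hL] at h
      exact h
    -- class factor of `Wd` = field factor, a unit
    have hcls' : ¬ ‖bernoulliOnePrim ψ'⁻¹‖ ≤ (p : ℝ)⁻¹ := by
      rw [OffLocusTwistFactor.classFactor_twist_eq_fieldFactor W h5 ψ ω hψ hω hss K hK εK hεK ψ' ω' hψ' hω' hssX]
      exact hfld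
    -- the partner's own odd datum; its class factor is that of `Wd` (isogeny invariance)
    obtain ⟨f₁, hf₁, ψ₁, ω₁, -, -, hψ₁, hω₁, hss₁, -, -, -, -⟩ :=
      OffLocusDictionary.exists_krizLiTriple_odd_of_cmRamified W₁ p hCM₁ hram₁ h5 K hK.1
    haveI := hf₁
    obtain ⟨φ, -⟩ := hφ
    have hiso : IsIsogenous Wd W₁ := ⟨φ⟩
    have hcls₁ : ¬ ‖bernoulliOnePrim ψ₁⁻¹‖ ≤ (p : ℝ)⁻¹ := by
      rw [← classFactor_eq_of_isIsogenous h5 Wd W₁ hiso ψ' ψ₁ ω' ω₁ hψ' hψ₁ hω' hω₁ hss' hss₁]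
      exact hcls'
    -- (α′) on the partner and `r_an(W₁) = 0`
    have hsel₁ := LevelDictionaryAlpha.natCard_selmerGroup_le_of_unit_classFactor W₁ p hCM₁ hram₁ h5 ψ₁ ω₁ hψ₁ hω₁ hss₁ hcls₁
    have hLd1 : Wd.entireLFunction 1 ≠ 0 := by rw [← hCd, entireLFunction_smul]; exact hLt
    have hrd : Wd.analyticRank = 0 := analyticRank_eq_zero_of_entireLFunction_one_ne_zero Wd hLd1
    have hr₁ : W₁.analyticRank = 0 := by rw [← analyticRank_eq_of_isIsogenous' hiso]; exact hrd
    have hW₁ := ParitySplit.noPTorsion_of_natCard_selmerGroup_le_of_analyticRank_zero W₁ p hCT hGZK hr₁ hsel₁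
    have hx : ((p : ℤ) • (⟨c, hc⟩ : W₁.sha)) = 0 := by rw [natCast_zsmul]; exact Subtype.ext hpc
    exact congrArg Subtype.val (hW₁ ⟨c, hc⟩ hx)

end Summit.BirchSwinnertonDyer.BirchSwinnertonDyer.Theorems.PrintCFram.HeegnerTwistSha

end
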